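import Mathlib
import Literature.NumberTheory.LFunctions.BernoulliOneOdd
import Summits.HodgeConjecture.FermatCycles.HodgeFermatTwistedMomentB

/-!
# LEMMA E (μ-part, m₀ = 3) for every odd Dirichlet character at a prime level (`HodgeFermat/LemmaEMu.lean`)

Tree copy (whole module) of the module `HodgeFermat/LemmaEMu.lean` of the sibling cell's standalone package
`run/shared/lean/pub/pub-hodgefermat/lean/HodgeFermat/` (248 lines, sha256 `0a224322bcf3da05…`), source lines 40–248 (all).
Filed by cell `pub-hfermat`, seat prover-1 gen-0, on the COORDINATOR KEEPER RULING of 2026-08-25 (gem sweep H1: take the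
off-gate kernel theorem `thmFstar` — `HodgeFermat/DecodingFinal.lean:29` — through the gate); this file is one link of the
minimal import closure of `thmFstar`.  The source module's declarations are VERBATIM those of the cell record
`check/DecodingFinal_standalone.lean` (27 bodies, 454 223 B, sha256 dca6f17de93119a6…, hub `lean check` rc 0, 130.1 s; pub-hodgefermat `CERT.md` l.978, GATE HF-G32).
Deviations from the source module, exhaustively: the `import` lines (tree modules `Summits.HodgeConjecture.FermatCycles.
HodgeFermat*` instead of `HodgeFermat.*`); this module docstring; DEDUP (gate `dedup.landed`, bounce of p397837): the source's `lemma ne_one_of_odd` (l.155–162) restates the landed `Literature.NumberTheory.LFunctions.BernoulliOneOdd.ne_one_of_odd` and is therefore DELETED; its three uses (source l.170, 174, 205) are byte-identical and now resolve to the Literature lemma through the added line `open Literature.NumberTheory.LFunctions.BernoulliOneOdd (ne_one_of_odd)` (extra import `Literature.NumberTheory.LFunctions.BernoulliOneOdd`). One-line docstrings added (gate lint) to `toFun_isChar`, `toFun_one`, `toFun_mul_inv`, `toFun_neg_one`, `mue_toFun`.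
Every other line — in particular every declaration's statement and proof — is byte-identical to the source.
HONEST FRAMING: explicit algebraic cycles for specific Hodge classes on Fermat/Delsarte varieties; residual open instances
listed; no claim on general Hodge.  (This file is arithmetic of CM types; it claims nothing about cycles.)

The source module's docstring (LemmaEMu.lean l.3–38), verbatim:

## LEMMA E (μ-part, m₀ = 3) for EVERY odd Dirichlet character at a prime level — the analytic cancellation (HF-G31c)

`HodgeFermat/TwistedMoment.lean` (HF-G31b) proves LEMMA E of `tables/DPRIME-THEOREM.md` §6 with `m₀ = 3` in
ALGEBRAIC form for characters with values in any commutative ring: for two zero-sum triples mod `3n` of the same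
CM type with entries units mod `n`, `3·S_n(ψ)·(Σ_T ê − Σ_T′ ê) + 3n·M_n(ψ)·(…) = 0` (`mu_identity`, `muw_eq`), where
`ê = mue ψ ψ̄` is the weight `ê_a(1 × ψ)` of (E0), `S_n(ψ) = Σ_{u unit} ψ(u)u` and `M_n(ψ) = Σ_u ψ(u)`.  LEMMA E proper
— `Σ_T ê = Σ_T′ ê`, i.e. `μ̂(ψ̄) = 0` — needs `M_n(ψ) = 0` and the CANCELLATION of `S_n(ψ)`, that is `S_n(ψ) ≠ 0`.

THIS FILE performs the cancellation for ALL odd Dirichlet characters `ψ : DirichletCharacter ℂ p` at a PRIME level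
`m₁ = p ≠ 3` (where every odd `ψ` is primitive, so the Bad set of LEMMA E is empty):
`S_p(ψ) = -p·L(ψ, 0)` (`moment_eq_LFunction`, from the Hurwitz special value `ζ(0, x) = 1/2 − x`, hypothesis `H0` —
VERBATIM the statement `HypBReduction.HypH0`, which `HurwitzZero.hypH0` proves; it is restated here so that this
module imports nothing of the analytic chain and checks in seconds) and `L(ψ, 0) ≠ 0` for odd primitive `ψ`
(`lfunction_zero_ne_zero`: functional equation + Dirichlet's `L(ψ⁻¹, 1) ≠ 0`, Mathlib; the 30-line argument of
`HypBReduction.lean` §3 repeated to keep the cone light).  Main result: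

* `lemmaE_mu (h0 : H0) (hp : p.Prime) (hp3 : p ≠ 3) (ψ : DirichletCharacter ℂ p) (hψ : ψ.Odd) … (hT : SameType (3 * p)
  (a, b, c) (a', b', c')) : ehat ψ a + ehat ψ b + ehat ψ c = ehat ψ a' + ehat ψ b' + ehat ψ c'` — for two zero-sum
  triples mod `3p` with entries prime to `p` and the same CM type, and EVERY odd character `ψ` mod `p`, the sums of the
  (E0) weights `ê(x) = (1 − ψ(3))·ψ⁻¹(x)` (`3 ∤ x`), `2·ψ⁻¹(x/3)` (`3 ∣ x`) agree (`ehat`); `HodgeFermat/LemmaEMuFinal.lean`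
  discharges `h0` by `HurwitzZero.hypH0` (heavy import, separate record).

This is LEMMA E's μ-part at the levels `m = 3p` in full (all odd `ψ`, no Bad characters), the input of DPRIME §7.1
("μ_T − μ_T′ is even"); THEOREM (Σμ, Legendre) of `MuLegendre.lean` is its real instance `ψ = (·/p)`, `p ≡ 3 (mod 4)`,
where the cancellation was done by parity instead.

Dictionary (`toFun`, `toFun_isChar`, `toFun_mul_inv`, `toFun_neg_one`, `moment_toFun`): a `DirichletCharacter ℂ p`
as the bare function `x ↦ ψ (x : ZMod p)` is an `IsChar p`, with `ψ⁻¹` as the conjugate datum, odd iff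
`toFun ψ (p - 1) = -1`, and `moment p (toFun ψ) = Σ_{j : ZMod p} ψ(j)·val j`.

LIGHT module: imports `TwistedMoment` (cone LemmaN → ChiThree → TwistedMoment); no `sorry`; no `decide`; axioms
[propext, Classical.choice, Quot.sound] (hub record `check/MuEven_standalone.lean` — this module together with `MuEven.lean` —
JSON under `results/gen31/local/lean/`).
NOT imported by the root `HodgeFermat.lean`.
-/

namespace HodgeFermat.KRFree.LemmaEMu

open Finset HodgeFermat.KRFree.LemmaN HodgeFermat.KRFree.TwistedMoment HurwitzZeta
open HodgeFermat.KRFree.ChiThree (units)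
open Literature.NumberTheory.LFunctions.BernoulliOneOdd (ne_one_of_odd)

/-- HYPOTHESIS H0, verbatim `HypBReduction.HypH0` (`ζ(0, x) = 1/2 − x` for `0 < x < 1`, Mathlib's `hurwitzZeta` on
`ℝ/ℤ`); a theorem (`HurwitzZero.hypH0`), kept as a hypothesis in this light module. -/
def H0 : Prop :=
  ∀ x : ℝ, 0 < x → x < 1 → hurwitzZeta ((x : ℝ) : UnitAddCircle) 0 = 1 / 2 - (x : ℂ)

/-! ## 1. Dirichlet characters as bare functions -/

section dictionary

variable {p : ℕ}

/-- a Dirichlet character mod `p` as a bare function on `ℕ` -/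
noncomputable def toFun (ψ : DirichletCharacter ℂ p) (x : ℕ) : ℂ := ψ (x : ZMod p)

/-- `toFun ψ` is a character mod `p` in the sense of `TwistedMoment.IsChar` -/
lemma toFun_isChar (ψ : DirichletCharacter ℂ p) : IsChar p (toFun ψ) where
  periodic x := by unfold toFun; rw [ZMod.natCast_mod]
  mul x y := by unfold toFun; rw [Nat.cast_mul, map_mul]

/-- `toFun ψ 1 = 1` -/
lemma toFun_one (ψ : DirichletCharacter ℂ p) : toFun ψ 1 = 1 := by
  unfold toFun; rw [Nat.cast_one, map_one]

/-- `ψ(x)·ψ⁻¹(x) = 1` for `x` prime to `p` -/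
lemma toFun_mul_inv (ψ : DirichletCharacter ℂ p) {x : ℕ} (hx : Nat.Coprime x p) :
    toFun ψ x * toFun ψ⁻¹ x = 1 := by
  unfold toFun
  have hu : IsUnit ((x : ℕ) : ZMod p) := by
    rw [← ZMod.coe_unitOfCoprime x hx]; exact Units.isUnit _
  rw [← MulChar.mul_apply, mul_inv_cancel, MulChar.one_apply hu]

/-- an odd `ψ` has `ψ(p − 1) = −1` -/
lemma toFun_neg_one (ψ : DirichletCharacter ℂ p) (hψ : ψ.Odd) (h1p : 1 < p) : toFun ψ (p - 1) = -1 := by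
  unfold toFun
  rw [Nat.cast_sub h1p.le, Nat.cast_one, ZMod.natCast_self, zero_sub]
  exact hψ

/-- the (E0) weight of DPRIME §6 for `χ = 1 × ψ`: `ê(x) = (1 − ψ(3))·ψ⁻¹(x)` if `3 ∤ x`, `2·ψ⁻¹(x/3)` if `3 ∣ x` -/
noncomputable def ehat (ψ : DirichletCharacter ℂ p) (x : ℕ) : ℂ :=
  if 3 ∣ x then 2 * ψ⁻¹ ((x / 3 : ℕ) : ZMod p) else (1 - ψ (3 : ZMod p)) * ψ⁻¹ (x : ZMod p)

/-- dictionary: `mue (toFun ψ) (toFun ψ⁻¹) = ehat ψ` -/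
lemma mue_toFun (ψ : DirichletCharacter ℂ p) (x : ℕ) : mue (toFun ψ) (toFun ψ⁻¹) x = ehat ψ x := by
  unfold mue ehat toFun
  rw [Nat.cast_ofNat]

variable [NeZero p]

/-- `S_p(ψ) = Σ_{j : ZMod p} ψ(j)·val(j)` at a prime `p` (the only non-unit residue is `0`) -/
lemma moment_toFun (hp : p.Prime) (ψ : DirichletCharacter ℂ p) :
    moment p (toFun ψ) = ∑ j : ZMod p, ψ j * ((j.val : ℕ) : ℂ) := by
  unfold moment toFun
  have h1 : ∑ u ∈ units p, ψ ((u : ℕ) : ZMod p) * (u : ℂ) = ∑ t ∈ range p, ψ ((t : ℕ) : ZMod p) * (t : ℂ) := by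
    unfold units
    rw [Finset.sum_filter]
    refine Finset.sum_congr rfl (fun t ht => ?_)
    by_cases h : Nat.Coprime t p
    · simp [h]
    · have hdvd : p ∣ t := by
        by_contra hnd
        exact h (Nat.coprime_comm.mp ((Nat.Prime.coprime_iff_not_dvd hp).mpr hnd))
      have ht0 : t = 0 := Nat.eq_zero_of_dvd_of_lt hdvd (mem_range.mp ht)
      simp [ht0]
  rw [h1]
  refine Finset.sum_nbij' (fun t => ((t : ℕ) : ZMod p)) (fun j => j.val) ?_ ?_ ?_ ?_ ?_
  · intro t _; exact mem_univ _
  · intro j _; exact mem_range.mpr (ZMod.val_lt j)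
  · intro t ht
    exact ZMod.val_natCast_of_lt (mem_range.mp ht)
  · intro j _; exact ZMod.natCast_zmod_val j
  · intro t ht
    rw [ZMod.val_natCast_of_lt (mem_range.mp ht)]

/-! ## 2. `S_p(ψ) = -p · L(ψ, 0)` for odd `ψ` (from H0) -/

/-- `ζ(0, j/p) = 1/2 − val(j)/p` for `j ≠ 0` (from H0) — as `HypBReduction.hurwitzZeta_toAddCircle_zero`. -/
theorem hurwitzZeta_toAddCircle_zero (h0 : H0) {j : ZMod p} (hj : j ≠ 0) :
    hurwitzZeta (ZMod.toAddCircle j) 0 = 1 / 2 - ((j.val : ℕ) : ℂ) / p := by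
  rw [ZMod.toAddCircle_apply]
  have hN : (0 : ℝ) < p := Nat.cast_pos.mpr (NeZero.pos p)
  have hv : 0 < j.val := Nat.pos_of_ne_zero (fun h => hj ((ZMod.val_eq_zero j).mp h))
  have h1 : (0 : ℝ) < (j.val : ℝ) / p := div_pos (by exact_mod_cast hv) hN
  have h2 : (j.val : ℝ) / p < 1 := by
    rw [div_lt_one hN]
    exact_mod_cast ZMod.val_lt j
  rw [h0 _ h1 h2]
  push_cast
  ring

/-- `L(Φ, 0) = -(1/p) Σ_j Φ(j)·val(j)` for an odd function `Φ` on `ℤ/p` (from H0) — as `HypBReduction.lfunction_zero_of_odd`. -/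
theorem lfunction_zero_of_odd (h0 : H0) {Φ : ZMod p → ℂ} (hΦ : Φ.Odd) :
    ZMod.LFunction Φ 0 = -(∑ j : ZMod p, Φ j * ((j.val : ℕ) : ℂ)) / p := by
  have hΦ0 : Φ 0 = 0 := hΦ.map_zero
  have hsum : ∑ j : ZMod p, Φ j = 0 := hΦ.sum_eq_zero
  have hterm : ∀ j : ZMod p, Φ j * hurwitzZeta (ZMod.toAddCircle j) 0
      = Φ j * (1 / 2) - Φ j * ((j.val : ℕ) : ℂ) / p := by
    intro j
    by_cases hj : j = 0
    · subst hj
      simp [hΦ0]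
    · rw [hurwitzZeta_toAddCircle_zero h0 hj]
      ring
  simp only [ZMod.LFunction, neg_zero, Complex.cpow_zero, one_mul]
  rw [Finset.sum_congr rfl (fun j _ => hterm j), Finset.sum_sub_distrib, ← Finset.sum_mul, hsum,
    zero_mul, zero_sub, ← Finset.sum_div, neg_div]

/-- `S_p(ψ) = -p · L(ψ, 0)` for an odd character `ψ` mod a prime `p` (from H0). -/
theorem moment_eq_LFunction (h0 : H0) (hp : p.Prime) (ψ : DirichletCharacter ℂ p) (hψ : ψ.Odd) :
    moment p (toFun ψ) = -(p : ℂ) * ψ.LFunction 0 := by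
  rw [moment_toFun hp, DirichletCharacter.LFunction, lfunction_zero_of_odd h0 hψ.to_fun]
  have hp0 : (p : ℂ) ≠ 0 := Nat.cast_ne_zero.mpr hp.ne_zero
  field_simp

/-! ## 3. `L(ψ, 0) ≠ 0` for odd primitive `ψ`; odd characters at a prime level are primitive -/


/-- `L(ψ, 0) ≠ 0` for `ψ` odd primitive — as `HypBReduction.lfunction_zero_ne_zero` (functional equation for `ψ⁻¹`
at `s = 0` and Dirichlet's theorem `L(ψ⁻¹, 1) ≠ 0`). -/
theorem lfunction_zero_ne_zero (ψ : DirichletCharacter ℂ p) (hprim : ψ.IsPrimitive) (hodd : ψ.Odd) :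
    ψ.LFunction 0 ≠ 0 := by
  have hf1 : p ≠ 1 := by
    rintro rfl
    exact ne_one_of_odd hodd (DirichletCharacter.level_one ψ)
  have hprim' : (ψ⁻¹).IsPrimitive := by
    rw [DirichletCharacter.isPrimitive_def, DirichletCharacter.conductor_inv]
    exact hprim
  have hne : ψ⁻¹ ≠ 1 := inv_ne_one.mpr (ne_one_of_odd hodd)
  have hFE := DirichletCharacter.IsPrimitive.completedLFunction_one_sub hprim' 0
  rw [inv_inv, sub_zero] at hFE
  have hL1 : DirichletCharacter.LFunction ψ⁻¹ 1 ≠ 0 := DirichletCharacter.LFunction_apply_one_ne_zero hne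
  have hΛ1 : DirichletCharacter.completedLFunction ψ⁻¹ 1 ≠ 0 := by
    intro h
    apply hL1
    rw [DirichletCharacter.LFunction_eq_completed_div_gammaFactor ψ⁻¹ 1 (Or.inl one_ne_zero), h,
      zero_div]
  have hΛ0 : DirichletCharacter.completedLFunction ψ 0 ≠ 0 := by
    intro h
    apply hΛ1
    rw [hFE, h, mul_zero]
  intro h
  apply hΛ0
  have h' := DirichletCharacter.LFunction_eq_completed_div_gammaFactor ψ 0 (Or.inr hf1)
  rw [hodd.gammaFactor_def, zero_add, Complex.Gammaℝ_one, div_one] at h'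
  rw [← h', h]

/-- at a PRIME level every non-trivial character is primitive (the conductor divides `p` and is not `1`) -/
lemma isPrimitive_of_prime (hp : p.Prime) {ψ : DirichletCharacter ℂ p} (hψ : ψ ≠ 1) : ψ.IsPrimitive := by
  rw [DirichletCharacter.isPrimitive_def]
  rcases (Nat.dvd_prime hp).mp (DirichletCharacter.conductor_dvd_level ψ) with h | h
  · exact absurd (DirichletCharacter.eq_one_iff_conductor_eq_one.mpr h) hψ
  · exact h

/-- `S_p(ψ) ≠ 0` for every odd character `ψ` mod a prime `p` (from H0): the Bad set of LEMMA E at `m₁ = p` is empty. -/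
theorem moment_ne_zero (h0 : H0) (hp : p.Prime) (ψ : DirichletCharacter ℂ p) (hψ : ψ.Odd) :
    moment p (toFun ψ) ≠ 0 := by
  rw [moment_eq_LFunction h0 hp ψ hψ]
  exact mul_ne_zero (neg_ne_zero.mpr (Nat.cast_ne_zero.mpr hp.ne_zero))
    (lfunction_zero_ne_zero ψ (isPrimitive_of_prime hp (ne_one_of_odd hψ)) hψ)

end dictionary

/-! ## 4. LEMMA E, μ-part, `m₀ = 3`, all odd `ψ` at a prime level -/

/-- **LEMMA E (μ-part, m₀ = 3, prime level; from H0).**  Let `p ≠ 3` be a prime, `ψ` an ODD Dirichlet character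
mod `p`, and let `T = (a, b, c)`, `T′ = (a′, b′, c′)` have zero sums mod `3p`, all entries prime to `p`, and the same
CM type at level `3p`.  Then `Σ_{x ∈ T} ê(x) = Σ_{x ∈ T′} ê(x)` for the (E0) weight `ê(x) = (1 − ψ(3))·ψ⁻¹(x)` (`3 ∤ x`),
`2·ψ⁻¹(x/3)` (`3 ∣ x`) — i.e. `μ̂(ψ̄) = 0` for every odd `ψ` mod `m₁ = p`. -/
theorem lemmaE_mu (h0 : H0) {p : ℕ} (hp : p.Prime) (hp3 : p ≠ 3) (ψ : DirichletCharacter ℂ p) (hψ : ψ.Odd)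
    {a b c a' b' c' : ℕ} (hs : 3 * p ∣ a + b + c) (hs' : 3 * p ∣ a' + b' + c')
    (ha : Nat.Coprime a p) (hb : Nat.Coprime b p) (hc : Nat.Coprime c p)
    (ha' : Nat.Coprime a' p) (hb' : Nat.Coprime b' p) (hc' : Nat.Coprime c' p)
    (hT : SameType (3 * p) (a, b, c) (a', b', c')) :
    ehat ψ a + ehat ψ b + ehat ψ c = ehat ψ a' + ehat ψ b' + ehat ψ c' := by
  haveI : NeZero p := ⟨hp.ne_zero⟩
  have h1p : 1 < p := hp.one_lt
  have h3p : ¬ 3 ∣ p := fun h => hp3 ((Nat.prime_dvd_prime_iff_eq Nat.prime_three hp).mp h).symm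
  have key := mu_identity (toFun_isChar ψ) h1p h3p (fun x hx => toFun_mul_inv ψ hx)
    hs hs' ha hb hc ha' hb' hc' hT
  have hM : mass p (toFun ψ) = 0 :=
    mass_eq_zero_of_odd (toFun_isChar ψ) h1p (toFun_neg_one ψ hψ h1p) (fun z hz => by
      rcases mul_eq_zero.mp hz with h | h
      · norm_num at h
      · exact h)
  simp only [muw_eq (toFun_isChar ψ) h1p h3p (toFun_one ψ), hM, mul_zero, zero_mul, add_zero,
    mue_toFun] at key
  have h3S : (3 : ℂ) * moment p (toFun ψ) ≠ 0 := mul_ne_zero (by norm_num) (moment_ne_zero h0 hp ψ hψ)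
  apply mul_left_cancel₀ h3S
  linear_combination key

/-- The same in the `mue`/`toFun` vocabulary of `TwistedMoment` (for gluing). -/
theorem mue_sum_eq (h0 : H0) {p : ℕ} (hp : p.Prime) (hp3 : p ≠ 3) (ψ : DirichletCharacter ℂ p) (hψ : ψ.Odd)
    {a b c a' b' c' : ℕ} (hs : 3 * p ∣ a + b + c) (hs' : 3 * p ∣ a' + b' + c')
    (ha : Nat.Coprime a p) (hb : Nat.Coprime b p) (hc : Nat.Coprime c p)
    (ha' : Nat.Coprime a' p) (hb' : Nat.Coprime b' p) (hc' : Nat.Coprime c' p)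
    (hT : SameType (3 * p) (a, b, c) (a', b', c')) :
    mue (toFun ψ) (toFun ψ⁻¹) a + mue (toFun ψ) (toFun ψ⁻¹) b + mue (toFun ψ) (toFun ψ⁻¹) c
      = mue (toFun ψ) (toFun ψ⁻¹) a' + mue (toFun ψ) (toFun ψ⁻¹) b' + mue (toFun ψ) (toFun ψ⁻¹) c' := by
  simp only [mue_toFun]
  exact lemmaE_mu h0 hp hp3 ψ hψ hs hs' ha hb hc ha' hb' hc' hT

end HodgeFermat.KRFree.LemmaEMu
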